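import Summits.QuantumFields.YangMills.Theorems.BalabanUVNodesN15KingModelTranslationCovarianceReflections
import Summits.QuantumFields.YangMills.Theorems.BalabanUVNodesN15KingModelGaussianLawIdentification
import Literature.Probability.LatticeModels.GaussianPrecisionReflectionPositivity
import HarnessLib

/-!
# BalabanUVNodes ∕ N15 — THE KING-MODEL RUNG (PART Ϗ-a): THE MASSIVE FREE LATTICE FIELD ON KING's FINITE TORUS IS REFLECTION POSITIVE
# for the block-face reflection `σ_κ : x_κ ↦ −1 − x_κ` (between sites) in EVERY direction with an even number of sites — Glimm–Jaffe's Thm. 7.10.3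
# («the lattice analog» of torus reflection positivity) for King's fine-lattice covariance `B⁻¹ = (c(−Δ) + m²)⁻¹`, by the precision criterion
# (Track A, DAG node N15 = NE2; FAN-OUT v1.1 §N15 s3 «KING-MODEL RUNG»; count-neutral)

HONEST FRAMING.  Count-neutral (cell `pub-ymgap`, seat `pub-ymgap-dag-n15-e` g37; `--supports stmt-QuantumFields-27366 --as helper` = K3⁸).  King's `A = 0`, `g = 0` model
([King1986] C. King, Commun. Math. Phys. **102** (1986) 649–677, (2.13) p.653, (4.4) p.670): the massive free FINE-lattice operator `B = c(−Δ) + m²` on a finite torus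
`Π_μ ℤ∕K_μ` (`King1986.Torus.lapF`).  The reflection is dag-n15-a's block-face reflection `torRefl K κ` (`x_κ ↦ −1 − x_κ`, the hyperplane BETWEEN the sites
`x_κ = −1` and `x_κ = 0`, and between `x_κ = K_κ∕2 − 1` and `x_κ = K_κ∕2`), the positive half is the half torus `{x : val x_κ < K_κ∕2}` — for EVEN `K_κ` the
reflection swaps it with its complement (paired reflections on a torus, Glimm–Jaffe §7.10 Fig. 7.1).  ★★★ **`freeField_isReflectionPositive_torus`**: the Gaussian
field `N(0, B⁻¹)` (the tree's `gaussianFieldOfKernel`) is REFLECTION POSITIVE ON ALL BOUNDED HALF-TORUS OBSERVABLES (the tree's `IsReflectionPositive`), in every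
direction `κ` with `K_κ` even, `c ≥ 0`, `m² > 0`; ★★ the same for King's density-defined law `ρ_B(φ)dφ` (`gaussLaw`, part Ϝ-u's identification).  MECHANISM (the new
Literature criterion `GaussianPrecisionReflectionPositivity`): `B` is `σ`-invariant (dag-n15-d FILE 66 `lapF_torRefl`), positive definite, and FERROMAGNETIC ACROSS THE
CUT — the only entries `B(x, σy)` with `x, y` in the half are the mirror-diagonal ones `B(x, σx) = −c·#{bonds from x across the cut} ≤ 0` (★ `eq_of_cut_bond`: a bond
crossing the cut joins a boundary site to its mirror image).  NOT Bałaban's covariant objects; NOT a node discharge; nothing continuum ∕ `ℝ⁴` ∕ OS axioms ∕ mass gap ∕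
Clay.  0 `sorry`, 0 `def` (the half torus is written `{x | val x_κ < K_κ∕2}`, the reflection as the permutation `Function.Involutive.toPerm (torRefl K κ) torRefl_torRefl`).

WHAT THIS FILE PROVES (kernel).  §1 `unitVec_apply_same'`, `unitVec_apply_ne'`, ★ `torRefl_mem_half_iff` (σ swaps the halves), ★ `eq_of_cut_bond`, `torRefl_ne_of_mem_half`;
§2 `lapF_apply_torRefl_of_ne`, `lapF_apply_torRefl_self_nonpos`, ★ `lapF_cut_nonpos`, `lapF_posDef`; §3 ★★★ **`lapF_inv_reflection_positive`** (reflected Gram of `B⁻¹` PSD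
along half-torus families), ★★★ **`freeField_isReflectionPositive_torus`**, `freeField_isReflectionPositiveReal_torus`, `freeField_isReflectionInvariant_torus`,
★★ `gaussLaw_lapF_isReflectionPositive` (King's `ρ_B dφ`).  Part Ϗ-b (`…KingModelTorusReflectionPositivity`) pushes this through the blocks to King's `G_k`, `S₂^{(K)}`
and the RG block-field laws `dμ^{(K)} = N(0, (Δ^{(K)})⁻¹)`.

Locators (use): [King1986] (2.13) p.653, (4.4) p.670; Glimm–Jaffe 1987 §7.10 Thm. 7.10.3 (lattice ∕ periodic lattice analog), Def. 7.10.2; FILS 1978 Thm. 2.1.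
-/

noncomputable section

open scoped BigOperators
open Finset Matrix MeasureTheory

namespace Summit.QuantumFields.YangMills.BalabanUVNodes.N15KingModelRung.TorusRP

open Literature.MathematicalPhysics.QuantumFieldTheory (IsPosSemidefKernel gaussianFieldOfKernel)
open Literature.MathematicalPhysics.QuantumFieldTheory.Balaban1983to89.B5Prop11Plancherel (Tor fine unitVec)
open Literature.MathematicalPhysics.QuantumFieldTheory.Balaban1983to89.QGQInverse (Coercive)
open Literature.MathematicalPhysics.QuantumFieldTheory.King1986.Torus (lapF lapF_comm lapF_coercive)
open Literature.Probability.LatticeModels (IsReflectionPositive IsReflectionPositiveReal IsReflectionInvariant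
  reflectedCovariance_family_nonneg_of_precision gaussianField_isReflectionPositive_of_precision
  gaussianField_isReflectionPositiveReal_of_precision gaussianField_isReflectionInvariant_of_precision cut_nonpos_of_nearestNeighbour)
open Summit.QuantumFields.YangMills.BalabanUVNodes.N15.TwoGrid (torRefl torRefl_torRefl torRefl_apply_same torRefl_apply_ne torRefl_injective)
open Summit.QuantumFields.YangMills.BalabanUVNodes.N15.KingModel.SrcDiv (val_torRefl_same lapF_torRefl)
open Summit.QuantumFields.YangMills.BalabanUVNodes.N15KingModelRung.FreeField (gaussLaw gaussLaw_eq_gaussianFieldOfKernel)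

variable {d : ℕ}

/-! ## §1 The half torus `{val x_κ < K_κ∕2}` and the block-face reflection `σ_κ` -/

section Half

variable {K : Fin (d + 1) → ℕ} [∀ μ, NeZero (K μ)] (κ : Fin (d + 1))

omit [∀ μ, NeZero (K μ)] in
/-- `(e_μ)_μ = 1`. [folklore] -/
theorem unitVec_apply_same' (μ : Fin (d + 1)) : unitVec K μ μ = 1 := by
  simp [unitVec]

omit [∀ μ, NeZero (K μ)] in
/-- `(e_μ)_ν = 0` for `ν ≠ μ`. [folklore] -/
theorem unitVec_apply_ne' {μ ν : Fin (d + 1)} (h : ν ≠ μ) : unitVec K μ ν = 0 := by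
  simp [unitVec, h]

/-- ★ **For an even side the block-face reflection SWAPS the half torus with its complement**: `σ_κ x ∈ {val x_κ < K_κ∕2} ↔ x ∉ {val x_κ < K_κ∕2}`
(paired reflections on a torus: the hyperplanes between `−1, 0` and between `K_κ∕2 − 1, K_κ∕2`). [cite: GlimmJaffe1987, §7.10 Thm. 7.10.2 (Fig. 7.1)] -/
theorem torRefl_mem_half_iff (hK : Even (K κ)) (x : Tor K) :
    torRefl K κ x ∈ {x : Tor K | (x κ).val < K κ / 2} ↔ x ∉ {x : Tor K | (x κ).val < K κ / 2} := by
  simp only [Set.mem_setOf_eq, not_lt, val_torRefl_same]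
  obtain ⟨m, hm⟩ := hK
  have hx : (x κ).val < K κ := ZMod.val_lt _
  omega

/-- `σy ≠ x` for `x, y` in the half torus. [cite: GlimmJaffe1987, §7.10 Thm. 7.10.2] -/
theorem torRefl_ne_of_mem_half (hK : Even (K κ)) {x y : Tor K} (hx : (x κ).val < K κ / 2) (hy : (y κ).val < K κ / 2) :
    torRefl K κ y ≠ x := fun h =>
  ((torRefl_mem_half_iff κ hK y).mp (by rw [h]; exact hx)) hy

/-- ★ **A bond crossing the cut joins a boundary site to its mirror image**: if `σ_κ y = x ± e_μ` with `x, y` in the half torus then `x = y`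
(sideways bonds `μ ≠ κ` never cross; in direction `κ` only the layers `x_κ = 0` and `x_κ = K_κ∕2 − 1` couple to their reflections).
[cite: GlimmJaffe1987, §7.10 Thm. 7.10.3 (periodic lattice)] -/
theorem eq_of_cut_bond (hK : Even (K κ)) {x y : Tor K} (hx : (x κ).val < K κ / 2) (hy : (y κ).val < K κ / 2) {μ : Fin (d + 1)}
    (h : torRefl K κ y = x + unitVec K μ ∨ torRefl K κ y = x - unitVec K μ) : x = y := by
  have hK0 : 0 < K κ := Nat.pos_of_ne_zero (NeZero.ne _)
  obtain ⟨m, hm⟩ := hK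
  have hxlt : (x κ).val < K κ := ZMod.val_lt _
  have hylt : (y κ).val < K κ := ZMod.val_lt _
  have hval : ((torRefl K κ y) κ).val = K κ - 1 - (y κ).val := val_torRefl_same κ y
  by_cases hμ : μ = κ
  · subst hμ
    -- coordinates `ν ≠ μ` agree
    have hother : ∀ ν, ν ≠ μ → x ν = y ν := by
      intro ν hν
      rcases h with h | h
      · have e := congr_fun h ν
        rw [torRefl_apply_ne _ hν, Pi.add_apply, unitVec_apply_ne' hν, add_zero] at e
        exact e.symm
      · have e := congr_fun h ν
        rw [torRefl_apply_ne _ hν, Pi.sub_apply, unitVec_apply_ne' hν, sub_zero] at e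
        exact e.symm
    -- the `μ` coordinate: `−1 − y_μ = x_μ ± 1`
    have hsame : x μ = y μ := by
      apply ZMod.val_injective
      rcases h with h | h
      · have e := congr_fun h μ
        rw [torRefl_apply_same, Pi.add_apply, unitVec_apply_same'] at e
        -- `x_μ + y_μ + 2 = 0`
        have e2 : (((x μ).val + (y μ).val + 2 : ℕ) : ZMod (K μ)) = 0 := by
          push_cast
          rw [ZMod.natCast_zmod_val, ZMod.natCast_zmod_val]
          linear_combination (-1 : ZMod (K μ)) * e
        have hdvd : K μ ∣ (x μ).val + (y μ).val + 2 := (ZMod.natCast_eq_zero_iff _ _).mp e2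
        have hle : K μ ≤ (x μ).val + (y μ).val + 2 := Nat.le_of_dvd (by omega) hdvd
        omega
      · have e := congr_fun h μ
        rw [torRefl_apply_same, Pi.sub_apply, unitVec_apply_same'] at e
        -- `x_μ + y_μ = 0`
        have e2 : (((x μ).val + (y μ).val : ℕ) : ZMod (K μ)) = 0 := by
          push_cast
          rw [ZMod.natCast_zmod_val, ZMod.natCast_zmod_val]
          linear_combination (-1 : ZMod (K μ)) * e
        have hdvd : K μ ∣ (x μ).val + (y μ).val := (ZMod.natCast_eq_zero_iff _ _).mp e2
        by_cases h0 : (x μ).val + (y μ).val = 0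
        · omega
        · have hle : K μ ≤ (x μ).val + (y μ).val := Nat.le_of_dvd (Nat.pos_of_ne_zero h0) hdvd
          omega
    funext ν
    by_cases hν : ν = μ
    · subst hν; exact hsame
    · exact hother ν hν
  · -- a sideways bond: the `κ` coordinates of `σy` and `x` would agree
    exfalso
    have e : (torRefl K κ y) κ = x κ := by
      rcases h with h | h
      · rw [h, Pi.add_apply, unitVec_apply_ne' (fun h' => hμ h'.symm), add_zero]
      · rw [h, Pi.sub_apply, unitVec_apply_ne' (fun h' => hμ h'.symm), sub_zero]
    have e' := congr_arg ZMod.val e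
    rw [hval] at e'
    omega

end Half

/-! ## §2 The fine operator `B = c(−Δ) + m²` is ferromagnetic across the cut and positive definite -/

section Operator

variable {K : Fin (d + 1) → ℕ} [∀ μ, NeZero (K μ)] (κ : Fin (d + 1))

/-- `B(x, σy) = 0` for `x ≠ y` in the half torus: no bond crosses the cut except to the mirror image. [cite: King1986, (4.4) p.670] [cite: GlimmJaffe1987, §7.10 Thm. 7.10.3] -/
theorem lapF_apply_torRefl_of_ne (hK : Even (K κ)) (c m2 : ℝ) {x y : Tor K} (hx : (x κ).val < K κ / 2) (hy : (y κ).val < K κ / 2)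
    (hxy : x ≠ y) : lapF K c m2 x (torRefl K κ y) = 0 := by
  have hne : torRefl K κ y ≠ x := torRefl_ne_of_mem_half κ hK hx hy
  have hb1 : ∀ μ, torRefl K κ y ≠ x + unitVec K μ := fun μ h' => hxy (eq_of_cut_bond κ hK hx hy (Or.inl h'))
  have hb2 : ∀ μ, torRefl K κ y ≠ x - unitVec K μ := fun μ h' => hxy (eq_of_cut_bond κ hK hx hy (Or.inr h'))
  simp [lapF, hne, hb1, hb2]

/-- `B(x, σx) ≤ 0` on the half torus (`c ≥ 0`): the mirror-diagonal entry is `−c` times the number of bonds from `x` across the cut. [cite: King1986, (4.4) p.670] -/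
theorem lapF_apply_torRefl_self_nonpos (hK : Even (K κ)) {c : ℝ} (hc : 0 ≤ c) (m2 : ℝ) {x : Tor K} (hx : (x κ).val < K κ / 2) :
    lapF K c m2 x (torRefl K κ x) ≤ 0 := by
  have hne : torRefl K κ x ≠ x := torRefl_ne_of_mem_half κ hK hx hx
  simp only [lapF, hne, if_false, mul_zero, zero_sub, neg_nonpos]
  exact mul_nonneg hc (Finset.sum_nonneg fun μ _ => add_nonneg (by split_ifs <;> norm_num) (by split_ifs <;> norm_num))

/-- ★ **`B = c(−Δ) + m²` IS FERROMAGNETIC ACROSS THE CUT**: `Σ_{x,y} w_x B(x, σ_κ y) w_y ≤ 0` for every `w` supported in the half torus (`K_κ` even, `c ≥ 0`).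
[cite: King1986, (4.4) p.670] [cite: GlimmJaffe1987, §7.10 Thm. 7.10.3] [cite: FILS1978, Thm. 2.1] -/
theorem lapF_cut_nonpos (hK : Even (K κ)) {c : ℝ} (hc : 0 ≤ c) (m2 : ℝ) (w : Tor K → ℝ)
    (hw : ∀ x, x ∉ {x : Tor K | (x κ).val < K κ / 2} → w x = 0) :
    ∑ x, ∑ y, w x * lapF K c m2 x ((Function.Involutive.toPerm (torRefl K κ) torRefl_torRefl) y) * w y ≤ 0 :=
  cut_nonpos_of_nearestNeighbour (θ := Function.Involutive.toPerm (torRefl K κ) torRefl_torRefl) (P := {x : Tor K | (x κ).val < K κ / 2})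
    (fun _ hx _ hy hxy => lapF_apply_torRefl_of_ne κ hK c m2 hx hy hxy) (fun _ hx => lapF_apply_torRefl_self_nonpos κ hK hc m2 hx) w hw

/-- `B = c(−Δ) + m²` is positive definite (`c ≥ 0`, `m² > 0`; symmetric by `lapF_comm`, coercive `≥ m²` by `lapF_coercive`). [cite: King1986, (4.4) p.670] -/
theorem lapF_posDef {c m2 : ℝ} (hc : 0 ≤ c) (hm : 0 < m2) : (lapF K c m2).PosDef := by
  refine Matrix.PosDef.of_dotProduct_mulVec_pos ?_ fun x hx => ?_
  · show (lapF K c m2)ᴴ = lapF K c m2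
    rw [Matrix.conjTranspose_eq_transpose_of_trivial]
    ext z z'
    rw [Matrix.transpose_apply]
    exact lapF_comm K c m2 z z'
  · rw [star_trivial]
    have hcoe := lapF_coercive K c m2 hc x
    have hxx0 : 0 ≤ x ⬝ᵥ x := Finset.sum_nonneg fun i _ => mul_self_nonneg _
    have hxx : x ⬝ᵥ x ≠ 0 := fun h0 => hx (dotProduct_self_eq_zero.mp h0)
    have hxxp : 0 < x ⬝ᵥ x := lt_of_le_of_ne hxx0 (Ne.symm hxx)
    nlinarith [mul_pos hm hxxp]

end Operator

/-! ## §3 Reflection positivity of the massive free field on the torus (Glimm–Jaffe Thm. 7.10.3 for the periodic lattice) -/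

section RP

variable {K : Fin (d + 1) → ℕ} [∀ μ, NeZero (K μ)] (κ : Fin (d + 1))

/-- ★★★ **THE REFLECTED GRAM OF THE MASSIVE FREE TORUS COVARIANCE IS POSITIVE SEMIDEFINITE ON THE HALF TORUS**: for `K_κ` even, `c ≥ 0`, `m² > 0` and every
finite family `z_i` with `val (z_i)_κ < K_κ∕2`, `0 ≤ Σ_{i,j} a_i a_j B⁻¹(σ_κ z_i, z_j)` (`0 ≤ Π₊θCΠ₊`, Glimm–Jaffe Def. 7.10.2 ∕ Thm. 7.10.3, for King's `B = c(−Δ)+m²`).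
[cite: King1986, (2.13) p.653, (4.4) p.670] [cite: GlimmJaffe1987, §7.10 Thm. 7.10.3] -/
theorem lapF_inv_reflection_positive (hK : Even (K κ)) {c m2 : ℝ} (hc : 0 ≤ c) (hm : 0 < m2) (ι : Type) (s : Finset ι) (a : ι → ℝ)
    (z : ι → Tor K) (hz : ∀ i ∈ s, (z i κ).val < K κ / 2) :
    0 ≤ ∑ i ∈ s, ∑ j ∈ s, a i * a j * (lapF K c m2)⁻¹ (torRefl K κ (z i)) (z j) :=
  reflectedCovariance_family_nonneg_of_precision (lapF_posDef hc hm) (θ := Function.Involutive.toPerm (torRefl K κ) torRefl_torRefl)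
    torRefl_torRefl (fun x y => lapF_torRefl κ c m2 x y) (P := {x : Tor K | (x κ).val < K κ / 2}) (torRefl_mem_half_iff κ hK)
    (lapF_cut_nonpos κ hK hc m2) ι s a z hz

/-- ★★★ **THE MASSIVE FREE LATTICE FIELD ON THE TORUS IS REFLECTION POSITIVE** (Glimm–Jaffe Thm. 7.10.3): for `K_κ` even, `c ≥ 0`, `m² > 0`, the Gaussian field
`N(0, B⁻¹)` on `ℝ^{Π ℤ∕K_μ}` is reflection positive with respect to the block-face reflection `σ_κ` and the half torus `{val x_κ < K_κ∕2}` ON ALL BOUNDED OBSERVABLES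
measurable in the half-torus coordinates — `0 ≤ Re ∫ conj F(φ∘σ_κ)·F(φ) dN(0,B⁻¹)` (the tree's `IsReflectionPositive`).
[cite: King1986, (2.13) p.653, (4.4) p.670] [cite: GlimmJaffe1987, §7.10 Thm. 7.10.3, §6.2 Thm. 6.2.2] [cite: FILS1978, Thm. 2.1] -/
theorem freeField_isReflectionPositive_torus (hK : Even (K κ)) {c m2 : ℝ} (hc : 0 ≤ c) (hm : 0 < m2) :
    IsReflectionPositive (gaussianFieldOfKernel fun z z' : Tor K => (lapF K c m2)⁻¹ z z')
      (Function.Involutive.toPerm (torRefl K κ) torRefl_torRefl) {x : Tor K | (x κ).val < K κ / 2} :=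
  gaussianField_isReflectionPositive_of_precision (lapF_posDef hc hm) (Function.Involutive.toPerm (torRefl K κ) torRefl_torRefl)
    torRefl_torRefl (fun x y => lapF_torRefl κ c m2 x y) (torRefl_mem_half_iff κ hK) (lapF_cut_nonpos κ hK hc m2)

/-- The real form: `0 ≤ ∫ F(φ∘σ_κ) F(φ) dN(0,B⁻¹)` for bounded real half-torus observables. [cite: GlimmJaffe1987, §7.10 Thm. 7.10.3] [cite: Biskup2009, §5.1 Def. 5.2] -/
theorem freeField_isReflectionPositiveReal_torus (hK : Even (K κ)) {c m2 : ℝ} (hc : 0 ≤ c) (hm : 0 < m2) :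
    IsReflectionPositiveReal (gaussianFieldOfKernel fun z z' : Tor K => (lapF K c m2)⁻¹ z z')
      (Function.Involutive.toPerm (torRefl K κ) torRefl_torRefl) {x : Tor K | (x κ).val < K κ / 2} :=
  gaussianField_isReflectionPositiveReal_of_precision (lapF_posDef hc hm) (Function.Involutive.toPerm (torRefl K κ) torRefl_torRefl)
    torRefl_torRefl (fun x y => lapF_torRefl κ c m2 x y) (torRefl_mem_half_iff κ hK) (lapF_cut_nonpos κ hK hc m2)

/-- `N(0, B⁻¹)` is invariant under `φ ↦ φ∘σ_κ` (any side, `c ≥ 0`, `m² > 0`). [cite: King1986, (4.4) p.670] [cite: GlimmJaffe1987, §6.2 Thm. 6.2.2] -/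
theorem freeField_isReflectionInvariant_torus {c m2 : ℝ} (hc : 0 ≤ c) (hm : 0 < m2) :
    IsReflectionInvariant (gaussianFieldOfKernel fun z z' : Tor K => (lapF K c m2)⁻¹ z z')
      (Function.Involutive.toPerm (torRefl K κ) torRefl_torRefl) :=
  gaussianField_isReflectionInvariant_of_precision (lapF_posDef hc hm) (Function.Involutive.toPerm (torRefl K κ) torRefl_torRefl)
    (fun x y => lapF_torRefl κ c m2 x y)

omit [∀ μ, NeZero (K μ)] in
/-- `Bᵀ = B`. [cite: King1986, (4.4) p.670] -/
theorem lapF_transpose (c m2 : ℝ) : (lapF K c m2)ᵀ = lapF K c m2 := by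
  ext z z'
  rw [Matrix.transpose_apply]
  exact lapF_comm K c m2 z z'

/-- ★★ **KING's DENSITY-DEFINED FREE FINE-FIELD LAW `ρ_B(φ)dφ ∝ exp(−½⟨φ,Bφ⟩)dφ` IS REFLECTION POSITIVE ON THE TORUS** (part Ϝ-u's `gaussLaw B = N(0, B⁻¹)`; `K_κ` even).
[cite: King1986, (2.6) p.652, (2.13) p.653, (4.4) p.670] [cite: GlimmJaffe1987, §7.10 Thm. 7.10.3] -/
theorem gaussLaw_lapF_isReflectionPositive (hK : Even (K κ)) {c m2 : ℝ} (hc : 0 ≤ c) (hm : 0 < m2) :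
    IsReflectionPositive (gaussLaw (lapF K c m2)) (Function.Involutive.toPerm (torRefl K κ) torRefl_torRefl) {x : Tor K | (x κ).val < K κ / 2} := by
  rw [gaussLaw_eq_gaussianFieldOfKernel hm (lapF_coercive K c m2 hc) (lapF_transpose c m2)]
  exact freeField_isReflectionPositive_torus κ hK hc hm

/-- `ρ_B(φ)dφ` is reflection invariant. [cite: King1986, (2.6) p.652, (4.4) p.670] -/
theorem gaussLaw_lapF_isReflectionInvariant {c m2 : ℝ} (hc : 0 ≤ c) (hm : 0 < m2) :
    IsReflectionInvariant (gaussLaw (lapF K c m2)) (Function.Involutive.toPerm (torRefl K κ) torRefl_torRefl) := by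
  rw [gaussLaw_eq_gaussianFieldOfKernel hm (lapF_coercive K c m2 hc) (lapF_transpose c m2)]
  exact freeField_isReflectionInvariant_torus κ hc hm

end RP

end Summit.QuantumFields.YangMills.BalabanUVNodes.N15KingModelRung.TorusRP
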